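import Mathlib
import HarnessLib
import Summits.NavierStokesRegularity.NavierStokesRegularity.Theorems.TypeILiouvilleShorelinePlanarWallVertical
import Literature.Analysis.FluidPDE.BoundedWeakIsometry

/-!
# TypeILiouvilleShorelinePlanarWallAnyDirection — crux (L) stmt-NavierStokesRegularity-10661 `TypeIliouvilleL`:
# LOCALLY 2½-DIMENSIONAL ALONG ANY DIRECTION ⟹ TRIVIAL

Helper for stmt-NavierStokesRegularity-10661 (`--supports`); theorems only, no definitions, no named-fact hypotheses;
closes no item; Navier–Stokes regularity is NOT proved here (leafhand seat of the EulerZoomLiouville route; rotates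
`TypeILiouvilleShorelinePlanarWallVertical` from the coordinate direction `e₁` to an arbitrary unit vector).

* `exists_linearIsometryEquiv_map_eq_single` — for a unit vector `e` there is a linear isometry of `ℝ³` with `R e = e₁`
  (the reflection in the hyperplane orthogonal to `e − e₁`).
* `classP_const_of_locallyTranslationInvariant` — **a class-P flow which, on ONE nonempty open set of ONE slice `t₀ < 0`,
  is invariant under all small translations along some unit direction `e` is ONE CONSTANT VECTOR** (Euclidean twin by `R`
  is in class P — `classP_conj_linearIsometryEquiv`, `IsWeaklyDivFree.conj_linearIsometryEquiv` — and is locally invariant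
  along `e₁`; `classP_const_of_locallyLineInvariant`).  Every 2½-dimensional stratum of the (L) residual is empty.
[cite: KochNadirashviliSereginSverak2009, Thm. 5.1 (arXiv p. 9) and p. 13; LemarieRieusset2016, Thm. 9.12]
-/

noncomputable section
open MeasureTheory Filter Set Function Metric
open scoped Topology ENNReal RealInnerProductSpace
open Literature.Analysis Literature.Analysis.FluidPDE Literature.Analysis.UnboundedOperators
set_option linter.dupNamespace false
namespace Summit.NavierStokesRegularity.NavierStokesRegularity.Theorems.TypeILiouvilleShoreline

/-- For a unit vector `e` of `ℝ³` there is a linear isometry `R` with `R e = e₁ := EuclideanSpace.single 1 1`: the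
reflection in the hyperplane orthogonal to `e − e₁` (`e + e₁ ⊥ e − e₁` as `‖e‖ = ‖e₁‖`). [folklore] -/
theorem exists_linearIsometryEquiv_map_eq_single {e : EuclideanSpace ℝ (Fin 3)} (he : ‖e‖ = 1) :
    ∃ R : EuclideanSpace ℝ (Fin 3) ≃ₗᵢ[ℝ] EuclideanSpace ℝ (Fin 3), R e = EuclideanSpace.single 1 (1 : ℝ) := by
  set e₁ : EuclideanSpace ℝ (Fin 3) := EuclideanSpace.single 1 (1 : ℝ) with he₁
  have he₁n : ‖e₁‖ = 1 := by rw [he₁, EuclideanSpace.single, PiLp.norm_single, norm_one]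
  set d : EuclideanSpace ℝ (Fin 3) := e - e₁ with hd
  set K₀ : Submodule ℝ (EuclideanSpace ℝ (Fin 3)) := ℝ ∙ d with hK₀
  refine ⟨K₀ᗮ.reflection, ?_⟩
  have hRd : K₀ᗮ.reflection d = -d :=
    Submodule.reflection_mem_subspace_orthogonal_precomplement_eq_neg (Submodule.mem_span_singleton_self d)
  have hsum : e + e₁ ∈ K₀ᗮ := by
    rw [hK₀, Submodule.mem_orthogonal_singleton_iff_inner_right, hd, inner_sub_left, inner_add_right,
      inner_add_right, real_inner_self_eq_norm_sq, real_inner_self_eq_norm_sq, he, he₁n, real_inner_comm]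
    ring
  have hRs : K₀ᗮ.reflection (e + e₁) = e + e₁ := Submodule.reflection_mem_subspace_eq_self hsum
  have hdec : e = (1 / 2 : ℝ) • (e + e₁) + (1 / 2 : ℝ) • d := by
    rw [hd, smul_sub, smul_add]
    module
  calc K₀ᗮ.reflection e
      = (1 / 2 : ℝ) • K₀ᗮ.reflection (e + e₁) + (1 / 2 : ℝ) • K₀ᗮ.reflection d := by
        conv_lhs => rw [hdec]
        rw [map_add, LinearIsometryEquiv.map_smul, LinearIsometryEquiv.map_smul]
    _ = (1 / 2 : ℝ) • (e + e₁) + (1 / 2 : ℝ) • (-d) := by rw [hRs, hRd]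
    _ = e₁ := by rw [hd, smul_neg, smul_sub, smul_add]; module

/-- **LOCALLY 2½-DIMENSIONAL ALONG ANY DIRECTION ⟹ TRIVIAL (proved sector of (L)).**  A class-P flow with
`v t₀ (x + s•e) = v t₀ x` for `x` in ONE nonempty open set, all `|s| < δ`, some unit vector `e` and one `t₀ < 0`, is one
constant vector.  (Rotate `e` to `e₁` by a linear isometry; the Euclidean twin is in class P and locally invariant along
`e₁`; `classP_const_of_locallyLineInvariant`.) [cite: KochNadirashviliSereginSverak2009, Thm. 5.1 (arXiv p. 9), p. 13] -/
theorem classP_const_of_locallyTranslationInvariant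
    {v : ℝ → EuclideanSpace ℝ (Fin 3) → EuclideanSpace ℝ (Fin 3)}
    (hc : ContinuousOn (uncurry v) (Iio 0 ×ˢ univ))
    (hK : ∃ K : ℝ, ∀ t < 0, ∀ x, ‖v t x‖ ≤ K)
    (hd : ∀ t < 0, IsWeaklyDivFree (v t))
    (hm : ∀ s t : ℝ, s < t → t < 0 → ∀ x,
      v t x = heatExtension (v s) (t - s) x - oseenDuhamel 1 s v v t x)
    {e : EuclideanSpace ℝ (Fin 3)} (he : ‖e‖ = 1) {t₀ δ : ℝ} (ht₀ : t₀ < 0) (hδ : 0 < δ)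
    {U : Set (EuclideanSpace ℝ (Fin 3))} (hUo : IsOpen U) (hUne : U.Nonempty)
    (h : ∀ s ∈ Ioo (-δ) δ, ∀ x ∈ U, v t₀ (x + s • e) = v t₀ x) :
    ∃ b : EuclideanSpace ℝ (Fin 3), ∀ t < 0, ∀ x, v t x = b := by
  obtain ⟨R, hRe⟩ := exists_linearIsometryEquiv_map_eq_single he
  have hRe' : R.symm (EuclideanSpace.single 1 (1 : ℝ)) = e := by rw [← hRe, R.symm_apply_apply]
  -- the Euclidean twin is in class P
  obtain ⟨hwc, hwK, hwm⟩ := classP_conj_linearIsometryEquiv hc hK hm R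
  have hwd : ∀ t < 0, IsWeaklyDivFree (fun x => R (v t (R.symm x))) := fun t ht =>
    (hd t ht).conj_linearIsometryEquiv R
  -- the patch `R.symm ⁻¹' U` and the local invariance along `e₁`
  obtain ⟨x₀, hx₀⟩ := hUne
  have hU'o : IsOpen (R.symm ⁻¹' U) := hUo.preimage R.symm.continuous
  have hU'ne : (R.symm ⁻¹' U).Nonempty := ⟨R x₀, by simpa using hx₀⟩
  have h' : ∀ s ∈ Ioo (-δ) δ, ∀ x ∈ R.symm ⁻¹' U,
      (fun y => R (v t₀ (R.symm y))) (x + s • EuclideanSpace.single 1 (1 : ℝ)) = (fun y => R (v t₀ (R.symm y))) x := by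
    intro s hs x hx
    simp only
    rw [map_add, LinearIsometryEquiv.map_smul, hRe', h s hs (R.symm x) hx]
  obtain ⟨b, hb⟩ := classP_const_of_locallyLineInvariant (v := fun t y => R (v t (R.symm y))) hwc hwK hwd hwm ht₀ hδ
    hU'o hU'ne h'
  refine ⟨R.symm b, fun t ht x => ?_⟩
  have h1 := hb t ht (R x)
  simp only [R.symm_apply_apply] at h1
  rw [← h1, R.symm_apply_apply]

end Summit.NavierStokesRegularity.NavierStokesRegularity.Theorems.TypeILiouvilleShoreline

end
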